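import Mathlib
import Summits.MatrixMultiplication.MatrixMultiplication.Theorems.LieRankDesigns.Negative.Basics

/-!
# `LieRankDesigns` (stmt-MatrixMultiplication-7614), line `Sketch`: stub L `stub_levelOfFixedVector` — fixed vectors force the level

Crux `Summit.MatrixMultiplication.MatrixMultiplication.Theses.LevelGradedCohnUmans.LieRankDesigns`; skeleton
`Cruxes/LieRankDesigns/Lines/Sketch.lean` (lead prover-line-stmt-MatrixMultiplication-7614-0, registered stubs);
this file proves the registered stub `stub_levelOfFixedVector` verbatim (name + signature) and lands
`--supports stmt-MatrixMultiplication-7614`.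

Content (frame duality, hard half).  `G = GL_m(𝔽_p)`, `H = H_k` the frame stabiliser (the `h` whose first
`k` columns are those of `1`; the stabiliser subgroup of `diag(1^k, 0^{m-k})`: `mem_stabilizer_diagonal_iff`),
`F_k = levelSet p m k`.  HYPOTHESIS (the
sibling stub K): every frame function `g ↦ Σ_U φ U (g U)` (`U` an `m × k` matrix) lies in `F_k`.  CLAIM: an
irreducible character `χ = χ_ρ` with `Σ_{h ∈ H} χ(h) ≠ 0` lies in `F_k`.  Proof: the averaging operator
`S = Σ_{h ∈ H} ρ(h)` has trace `Σ_H χ ≠ 0`, so `u := S v ≠ 0` for some `v`, and `u` is `H`-fixed.  By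
irreducibility the orbit `ρ(b) u` spans `V` (`span_orbit_eq_top`), so each basis vector is
`e_i = Σ_b α_{ib} ρ(b) u` and `χ(g) = Σ_i e_i^*(ρ(g) e_i) = Σ_{i,b} α_{ib} T_i(g b)` with the matrix
coefficients `T_i(x) = e_i^*(ρ(x) u)`, which are right-`H`-invariant.  A right-`H`-invariant `T` translated by
`b` is a function of the first `k` columns of `g b`, i.e. of `g · col(b)`, hence a frame function
(`exists_frameFn`, via `Function.extend`) and in `F_k` by the hypothesis; `F_k` is a linear subspace
(`sum_mem_levelSet`), so `χ ∈ F_k`.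
-/

set_option linter.dupNamespace false

noncomputable section

open scoped BigOperators
open Literature.RepresentationTheory.FiniteGroups
open Summit.MatrixMultiplication.MatrixMultiplication.Theorems.LieRankDesigns.Negative
  (GLm Mat fourierFn RankSupp RankSep levelSet budget volume)

namespace Summit.MatrixMultiplication.MatrixMultiplication.Theorems.LieRankDesigns

namespace LevelOfFixedVector

open Module

variable {p m : ℕ}

/-! ### The frame stabiliser `H_k` as the stabiliser of the frame idempotent -/

/-- **The frame stabiliser is a stabiliser.**  For `h ∈ GL_m(𝔽_p)` and the idempotent
`E_k = diag(1, …, 1, 0, …, 0)` (`k` ones): `h E_k = E_k` iff the first `k` columns of `h` are those of the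
identity (`(h E_k)_{ji} = h_{ji} [i < k]`).  So `H_k` is the stabiliser subgroup of `E_k` for the left
multiplication action of `GL_m(𝔽_p)` on `M_m(𝔽_p)`, and no hand-made subgroup is needed. [folklore] -/
theorem mem_stabilizer_diagonal_iff (k : ℕ) (h : GLm p m) :
    h ∈ MulAction.stabilizer (GLm p m)
        (Matrix.diagonal fun i : Fin m => if (i : ℕ) < k then (1 : ZMod p) else 0) ↔
      ∀ i j : Fin m, (i : ℕ) < k → (h : Mat p m) j i = (1 : Mat p m) j i := by
  rw [MulAction.mem_stabilizer_iff, Units.smul_def, smul_eq_mul, ← Matrix.ext_iff]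
  simp only [Matrix.mul_diagonal, Matrix.diagonal_apply]
  constructor
  · intro hE i j hi
    have hji := hE j i
    rw [if_pos hi, mul_one] at hji
    rw [hji, Matrix.one_apply]
    by_cases hj : j = i
    · rw [if_pos hj, if_pos hj, if_pos (hj ▸ hi)]
    · rw [if_neg hj, if_neg hj]
  · intro hE i j
    by_cases hj : (j : ℕ) < k
    · rw [if_pos hj, mul_one, hE j i hj, Matrix.one_apply]
      by_cases hij : i = j
      · rw [if_pos hij, if_pos hij, if_pos (hij ▸ hj)]
      · rw [if_neg hij, if_neg hij]
    · rw [if_neg hj, mul_zero]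
      by_cases hij : i = j
      · rw [if_pos hij, if_neg (hij ▸ hj)]
      · rw [if_neg hij]

/-! ### The level `F_k` is a linear subspace of the functions on `GL_m(𝔽_p)` -/

section Level

variable [Fact p.Prime]

/-- `0 ∈ F_k` (zero coefficient table). -/
theorem zero_mem_levelSet (k : ℕ) : (fun _ : GLm p m => (0 : ℂ)) ∈ levelSet p m k :=
  ⟨0, fun M _ => rfl, fun g => by simp [fourierFn]⟩

/-- `F_k` is closed under addition (add the coefficient tables). -/
theorem add_mem_levelSet {k : ℕ} {f₁ f₂ : GLm p m → ℂ} (h₁ : f₁ ∈ levelSet p m k)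
    (h₂ : f₂ ∈ levelSet p m k) : (fun g => f₁ g + f₂ g) ∈ levelSet p m k := by
  obtain ⟨c₁, hc₁, hf₁⟩ := h₁
  obtain ⟨c₂, hc₂, hf₂⟩ := h₂
  refine ⟨c₁ + c₂, fun M hM => ?_, fun g => ?_⟩
  · simp only [Pi.add_apply, hc₁ M hM, hc₂ M hM, add_zero]
  · simp only [fourierFn, Pi.add_apply, hf₁ g, hf₂ g, add_mul, Finset.sum_add_distrib]

/-- `F_k` is closed under scalar multiplication (scale the coefficient table). -/
theorem smul_mem_levelSet {k : ℕ} {f : GLm p m → ℂ} (h : f ∈ levelSet p m k) (r : ℂ) :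
    (fun g => r * f g) ∈ levelSet p m k := by
  obtain ⟨c, hc, hf⟩ := h
  refine ⟨r • c, fun M hM => ?_, fun g => ?_⟩
  · simp only [Pi.smul_apply, hc M hM, smul_zero]
  · simp only [fourierFn, Pi.smul_apply, smul_eq_mul, hf g, Finset.mul_sum, mul_assoc]

/-- `F_k` is closed under finite sums. -/
theorem sum_mem_levelSet {k : ℕ} {ι : Type*} (s : Finset ι) (f : ι → GLm p m → ℂ)
    (h : ∀ i ∈ s, f i ∈ levelSet p m k) : (fun g => ∑ i ∈ s, f i g) ∈ levelSet p m k := by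
  classical
  induction s using Finset.induction_on with
  | empty =>
    have heq : (fun g : GLm p m => ∑ i ∈ (∅ : Finset ι), f i g) = fun _ => 0 :=
      funext fun g => Finset.sum_empty
    rw [heq]
    exact zero_mem_levelSet k
  | insert a s ha ih =>
    have heq : (fun g : GLm p m => ∑ i ∈ insert a s, f i g) = fun g => f a g + ∑ i ∈ s, f i g :=
      funext fun g => Finset.sum_insert ha
    rw [heq]
    exact add_mem_levelSet (h a (Finset.mem_insert_self a s))
      (ih fun i hi => h i (Finset.mem_insert_of_mem hi))

end Level

/-! ### Translates of right-`H_k`-invariant functions are frame functions -/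

/-- **Right-`H_k`-invariant functions factor through the first `k` columns.**  If `T (x h) = T x` for all
`h ∈ H_k`, then for every `b` the translate `g ↦ T (g b)` is a frame function `g ↦ Σ_U φ U (g U)`:
with `col x` the first `k` columns of `x` one has `col (x y) = x · col y` and `col x = col y ↔ x⁻¹ y ∈ H_k`,
so `T = Φ ∘ col` (`Function.extend`) and `T (g b) = Φ (g · col b)`; take `φ U W = [U = col b] Φ W`.
[folklore] -/
theorem exists_frameFn [Fact p.Prime] {k : ℕ} (hkm : k ≤ m) (H : Subgroup (GLm p m))
    (hH : ∀ h : GLm p m, h ∈ H ↔ ∀ i j : Fin m, (i : ℕ) < k → (h : Mat p m) j i = (1 : Mat p m) j i)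
    (T : GLm p m → ℂ) (hT : ∀ x : GLm p m, ∀ h ∈ H, T (x * h) = T x) (b : GLm p m) :
    ∃ φ : Matrix (Fin m) (Fin k) (ZMod p) → Matrix (Fin m) (Fin k) (ZMod p) → ℂ,
      ∀ g : GLm p m, T (g * b) = ∑ U : Matrix (Fin m) (Fin k) (ZMod p), φ U ((g : Mat p m) * U) := by
  classical
  -- `col x` = the first `k` columns of `x`
  obtain ⟨col, hcol⟩ : ∃ col : GLm p m → Matrix (Fin m) (Fin k) (ZMod p),
      ∀ x, col x = (x : Mat p m).submatrix id (Fin.castLE hkm) := ⟨_, fun _ => rfl⟩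
  have hmul : ∀ x y : GLm p m, col (x * y) = (x : Mat p m) * col y := fun x y => by
    rw [hcol, hcol, Units.val_mul, Matrix.submatrix_mul (x : Mat p m) (y : Mat p m) id id
      (Fin.castLE hkm) Function.bijective_id, Matrix.submatrix_id_id]
  have hmem : ∀ x : GLm p m, col x = col 1 → x ∈ H := fun x hx => by
    rw [hH]
    intro i j hi
    rw [hcol, hcol] at hx
    have h1 := congrFun (congrFun hx j) ⟨i, hi⟩
    have h2 : Fin.castLE hkm ⟨i, hi⟩ = i := Fin.ext rfl
    rw [Matrix.submatrix_apply, Matrix.submatrix_apply, Units.val_one, h2] at h1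
    exact h1
  have hfac : Function.FactorsThrough T col := by
    intro x y hxy
    have h1 : col (x⁻¹ * y) = col 1 := by
      rw [hmul, ← hxy, ← hmul, inv_mul_cancel]
    calc T x = T (x * (x⁻¹ * y)) := (hT x _ (hmem _ h1)).symm
      _ = T y := by rw [mul_inv_cancel_left]
  refine ⟨fun U W => if U = col b then Function.extend col T 0 W else 0, fun g => ?_⟩
  show T (g * b) = ∑ U : Matrix (Fin m) (Fin k) (ZMod p),
    (if U = col b then Function.extend col T 0 ((g : Mat p m) * U) else 0)
  rw [Fintype.sum_ite_eq' (col b) fun U => Function.extend col T 0 ((g : Mat p m) * U), ← hmul,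
    hfac.extend_apply]

/-! ### Representation theory: the orbit of a non-zero vector spans; fixed vectors; traces -/

/-- In an irreducible representation the orbit `ρ(b) u` (`b ∈ G`) of a non-zero vector `u` spans the whole
space: its span is a non-zero subrepresentation. [folklore] -/
theorem span_orbit_eq_top {G V : Type*} [Group G] [AddCommGroup V] [Module ℂ V]
    (ρ : Representation ℂ G V) (hρ : ρ.IsIrreducible) {u : V} (hu : u ≠ 0) :
    Submodule.span ℂ (Set.range fun b : G => ρ b u) = ⊤ := by
  haveI := hρ
  set W := Submodule.span ℂ (Set.range fun b : G => ρ b u) with hW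
  have hstab : ∀ g : G, ∀ y ∈ W, ρ g y ∈ W := by
    intro g y hy
    induction hy using Submodule.span_induction with
    | mem x hx =>
      obtain ⟨b, rfl⟩ := hx
      refine Submodule.subset_span ⟨g * b, ?_⟩
      simp only [map_mul, Module.End.mul_apply]
    | zero => rw [map_zero]; exact W.zero_mem
    | add x y _ _ hx hy => rw [map_add]; exact W.add_mem hx hy
    | smul a x _ hx => rw [map_smul]; exact W.smul_mem a hx
  have htop : (⊤ : Subrepresentation ρ).toSubmodule = ⊤ := rfl
  have hbot : (⊥ : Subrepresentation ρ).toSubmodule = ⊥ := rfl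
  rcases IsSimpleOrder.eq_bot_or_eq_top (⟨W, fun g y hy => hstab g y hy⟩ : Subrepresentation ρ)
    with h0 | h1
  · exfalso
    have hW0 : W = ⊥ := (congrArg Subrepresentation.toSubmodule h0).trans hbot
    have huW : u ∈ W := Submodule.subset_span ⟨1, by simp⟩
    rw [hW0, Submodule.mem_bot] at huW
    exact hu huW
  · exact (congrArg Subrepresentation.toSubmodule h1).trans htop

-- adapted from work/stubs/stub_levelFixedVector.lean (`LevelFixedVector.sum_char_mul_eq_zero`, step `hmem`)
/-- The values of the averaging operator `Σ_{x ∈ H} ρ(x)` are `H`-fixed (reindex by `x ↦ h x`). [folklore] -/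
theorem apply_sum_apply_eq {G V : Type*} [Group G] [AddCommGroup V] [Module ℂ V]
    (ρ : Representation ℂ G V) (H : Subgroup G) [Fintype H] (v : V) {h : G} (hh : h ∈ H) :
    ρ h ((∑ x : H, ρ (x : G)) v) = (∑ x : H, ρ (x : G)) v := by
  rw [LinearMap.sum_apply, map_sum]
  simp_rw [← Module.End.mul_apply, ← map_mul]
  exact Fintype.sum_equiv (Equiv.mulLeft ⟨h, hh⟩) _ _ fun x => rfl

/-- The trace in coordinates: `tr f = Σ_i e_i^*(f e_i)` for a basis `(e_i)` with dual basis `(e_i^*)`.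
[folklore] -/
theorem trace_eq_sum_coord {V : Type*} [AddCommGroup V] [Module ℂ V] {ι : Type*} [Fintype ι]
    [DecidableEq ι] (e : Basis ι ℂ V) (f : V →ₗ[ℂ] V) :
    LinearMap.trace ℂ V f = ∑ i, e.coord i (f (e i)) := by
  rw [LinearMap.trace_eq_matrix_trace ℂ e]
  simp only [Matrix.trace, Matrix.diag_apply, LinearMap.toMatrix_apply, Basis.coord_apply]

end LevelOfFixedVector

open Module LevelOfFixedVector in
/-- **Stub L `LevelOfFixedVector`** (registered signature; frame duality, hard half).  Assuming (stub K) that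
every frame function `g ↦ Σ_U φ U (g U)` lies in the level `F_k`: an irreducible character `χ = χ_ρ` of
`GL_m(𝔽_p)` with `Σ_{h ∈ H_k} χ(h) ≠ 0` lies in `F_k`.  Proof: `u := (Σ_{H_k} ρ h) v ≠ 0` for some `v`
(the operator has trace `Σ_{H_k} χ ≠ 0`) and `u` is `H_k`-fixed; its orbit spans `V` (irreducibility), so
`e_i = Σ_b α_{ib} ρ(b) u` for a basis `(e_i)`, and `χ(g) = Σ_i e_i^*(ρ(g) e_i) = Σ_{i,b} α_{ib} T_i(g b)` with
`T_i(x) = e_i^*(ρ(x) u)` right-`H_k`-invariant; each translate `g ↦ T_i(g b)` is a frame function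
(`exists_frameFn`), hence in `F_k` by the hypothesis, and `F_k` is a linear subspace.  (`1 ≤ k` is not used.) -/
theorem stub_levelOfFixedVector :
    (∀ (p m k : ℕ) [Fact p.Prime] (φ : Matrix (Fin m) (Fin k) (ZMod p) → Matrix (Fin m) (Fin k) (ZMod p) → ℂ),
      (fun g : GLm p m => ∑ U : Matrix (Fin m) (Fin k) (ZMod p), φ U ((g : Mat p m) * U)) ∈ levelSet p m k) →
    ∀ (p m k : ℕ) [Fact p.Prime], 1 ≤ k → k ≤ m → ∀ χ ∈ irrChars (GLm p m),
      (∑ᶠ h ∈ {h : GLm p m | ∀ i j : Fin m, (i : ℕ) < k → (h : Mat p m) j i = (1 : Mat p m) j i}, χ h) ≠ 0 →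
        χ ∈ levelSet p m k := by
  intro hK p m k _ _ hkm χ hχ hsum
  -- the frame stabiliser `H = H_k` (a stabiliser subgroup) and the `finsum` as a sum over `H`
  obtain ⟨H, hHmem⟩ : ∃ H : Subgroup (GLm p m), ∀ h : GLm p m,
      h ∈ H ↔ ∀ i j : Fin m, (i : ℕ) < k → (h : Mat p m) j i = (1 : Mat p m) j i :=
    ⟨_, mem_stabilizer_diagonal_iff k⟩
  classical
  have hconv : ∑ᶠ h ∈ {h : GLm p m | ∀ i j : Fin m, (i : ℕ) < k → (h : Mat p m) j i = (1 : Mat p m) j i},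
      χ h = ∑ h : H, χ h := by
    rw [finsum_mem_eq_finite_toFinset_sum χ (Set.toFinite _)]
    exact Finset.sum_subtype _ (fun h => by rw [Set.Finite.mem_toFinset, Set.mem_setOf_eq, hHmem]) χ
  rw [hconv] at hsum
  obtain ⟨V, _, _, _, ρ, hirr, rfl⟩ := id hχ
  -- a vector `v` not killed by the averaging operator `Σ_{x ∈ H} ρ x` (its trace is `Σ_H χ ≠ 0`)
  obtain ⟨v, hv⟩ : ∃ v : V, (∑ x : H, ρ (x : GLm p m)) v ≠ 0 := by
    by_contra hall
    apply hsum
    have h0 : (∑ x : H, ρ (x : GLm p m)) = 0 := by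
      ext w
      rw [LinearMap.zero_apply]
      by_contra hw
      exact hall ⟨w, hw⟩
    calc ∑ h : H, ρ.character h = LinearMap.trace ℂ V (∑ x : H, ρ (x : GLm p m)) := by
          rw [map_sum]; rfl
      _ = 0 := by rw [h0, map_zero]
  -- `u := (Σ_H ρ x) v ≠ 0` is `H`-fixed, and its orbit spans `V`
  obtain ⟨u, hu⟩ : ∃ u : V, u = (∑ x : H, ρ (x : GLm p m)) v := ⟨_, rfl⟩
  have hu0 : u ≠ 0 := hu ▸ hv
  have hfix : ∀ h ∈ H, ρ h u = u := fun h hh => by rw [hu]; exact apply_sum_apply_eq ρ H v hh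
  have hspan := span_orbit_eq_top ρ hirr hu0
  -- a basis `e` and orbit coefficients `α i` with `e i = Σ_b α i b • ρ b u`
  let e := Module.finBasis ℂ V
  have hcoef : ∀ i, ∃ α : GLm p m → ℂ, ∑ b, α b • ρ b u = e i := fun i =>
    (Submodule.mem_span_range_iff_exists_fun ℂ).mp (by rw [hspan]; exact Submodule.mem_top)
  choose α hα using hcoef
  -- the matrix coefficients `T i x = e_i^*(ρ x u)` are right-`H`-invariant
  obtain ⟨T, hT⟩ : ∃ T : Fin (finrank ℂ V) → GLm p m → ℂ, ∀ i x, T i x = e.coord i (ρ x u) :=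
    ⟨_, fun _ _ => rfl⟩
  have hTinv : ∀ i (x : GLm p m), ∀ h ∈ H, T i (x * h) = T i x := fun i x h hh => by
    rw [hT, hT, map_mul, Module.End.mul_apply, hfix h hh]
  -- `χ(g) = Σ_i Σ_b α i b * T i (g b)`
  have hchi : ∀ g : GLm p m, ρ.character g = ∑ i, ∑ b, α i b * T i (g * b) := by
    intro g
    change LinearMap.trace ℂ V (ρ g) = _
    rw [trace_eq_sum_coord e]
    refine Finset.sum_congr rfl fun i _ => ?_
    rw [← hα i, map_sum, map_sum]
    refine Finset.sum_congr rfl fun b _ => ?_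
    rw [map_smul, map_smul, smul_eq_mul, hT, map_mul, Module.End.mul_apply]
  -- each translate `g ↦ T i (g b)` is a frame function, hence in `F_k` by the hypothesis
  have hmemT : ∀ i (b : GLm p m), (fun g : GLm p m => T i (g * b)) ∈ levelSet p m k := by
    intro i b
    obtain ⟨φ, hφ⟩ := exists_frameFn hkm H hHmem (T i) (hTinv i) b
    have heq : (fun g : GLm p m => T i (g * b)) =
        fun g : GLm p m => ∑ U : Matrix (Fin m) (Fin k) (ZMod p), φ U ((g : Mat p m) * U) :=
      funext hφ
    rw [heq]
    exact hK p m k φ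
  -- `F_k` is a linear subspace
  have h1 : ∀ i (b : GLm p m), (fun g : GLm p m => α i b * T i (g * b)) ∈ levelSet p m k :=
    fun i b => smul_mem_levelSet (hmemT i b) (α i b)
  have h2 : ∀ i, (fun g : GLm p m => ∑ b, α i b * T i (g * b)) ∈ levelSet p m k := fun i =>
    sum_mem_levelSet Finset.univ (fun b g => α i b * T i (g * b)) fun b _ => h1 i b
  have h3 : (fun g : GLm p m => ∑ i, ∑ b, α i b * T i (g * b)) ∈ levelSet p m k :=
    sum_mem_levelSet Finset.univ (fun i g => ∑ b, α i b * T i (g * b)) fun i _ => h2 i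
  obtain ⟨c, hc, hfc⟩ := h3
  exact ⟨c, hc, fun g => (hchi g).trans (hfc g)⟩

end Summit.MatrixMultiplication.MatrixMultiplication.Theorems.LieRankDesigns

end
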